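import Summits.PneNP.PneNP.Theorems.ConstantBand.Negative.LoadBearing
import Summits.PneNP.PneNP.Theorems.SingleThreshold.Negative.LoadBearing
import Summits.PneNP.PneNP.Theorems.SliceACZero.Negative.WindowDepth
import Literature.Computability.Complexity.CliqueThresholdBounds

/-!
# Crux `SliceTarget` (stmt-PneNP-2832), line `Sketch-ideator3-r1`: stub B3 `PairBound` — auxiliary counting II

The reduction of the replica term of stub `stub_pairBound` (file `OneSliceSliceTargetPairBound.lean`) to a triple sum of
slice counts (`pb_replicaTripleSum`, exact finite statement, no asymptotics). For a read set `F` of slots (`U = Fᶜ`,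
`M = #U`), the slice `slice_j` splits into the fibres `Φ(ρ) = {x ∈ slice_j : x|_F = ρ|_F}`; with `a(ρ) = #{x ∈ Φ(ρ) : CLIQUE_k}`,
`c_B(ρ) = #{x ∈ Φ(ρ) : K_B ⊆ x}` (`B` a `k`-set, `K_B` its clique edges, `t_B = #(K_B ∖ F)`), `r = #(ρ⁻¹(1) ∩ F)`:

* fibre transport (private `pb_le_card_fibre`, `pb_card_fibre_supset_le`, re-derived from the sibling stub-T4 file
  `OneSliceSliceTargetFibreCliqueUpper.lean`, not yet importable here): `#Φ(ρ) ≥ C(M, j-r)` and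
  `#{x ∈ Φ(ρ) : S ⊆ x} ≤ C(M-#S, j-r-#S)` for `S ⊆ U`;
* `pb_fibre_count_mul_choose_le` — hence `c_B(ρ)·C(M, t_B) ≤ #Φ(ρ)·C(j-r, t_B)` (the identity
  `C(M-t, m-t)·C(M,t) = C(M,m)·C(m,t)`), and `c_B(ρ) = 0` unless `K_B ∩ F ⊆ ρ⁻¹(1)`;
* `pb_replicaTripleSum` — `Σ_ρ a(ρ)²/#Φ(ρ) ≤ Σ_B Σ_A Σ_{x ∈ slice_j, K_A ∪ (K_B ∩ F) ⊆ x} C(#(x ∖ F), t_B)/C(M, t_B)`: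
  `a(ρ)² ≤ a(ρ)·Σ_B c_B(ρ)` (union bound), `c_B/#Φ ≤ [K_B ∩ F ⊆ ρ]·C(j-r,t_B)/C(M,t_B)`, the sum over `ρ` of `a(ρ)·g(ρ)` is
  the sum over the clique graphs `x` of `g(x|_F)` (fibrewise), and a second union bound over the clique `K_A ⊆ x`.

Worker file for the line lead prover-line-stmt-PneNP-2832-0, 2026-08-16.
-/

set_option linter.dupNamespace false

namespace Summit.PneNP.PneNP.Cruxes.SliceTarget.Ideator3Line

open Literature.Computability.Complexity Finset Filter Classical
open scoped Topology
open Summit.PneNP.PneNP.Theorems.ConstantBand.Negative (Edge thr Central slice)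

noncomputable section

variable {n : ℕ}

/-! ## Fibres of a slice over a read set (re-derived from `OneSliceSliceTargetFibreCliqueUpper.lean`) -/

/-- Membership in a slice: `x ∈ slice n j ↔ e(x) = j`. [folklore] -/
private theorem pb_mem_slice_iff {j : ℕ} {x : Edge n → Bool} : x ∈ slice n j ↔ edgeCount x = j := by
  simp [Theorems.ConstantBand.Negative.slice]

/-- On a fibre over `F` the on-set meets `F` in the on-set of the pattern. [folklore] -/
private theorem pb_onSet_inter_eq {F : Finset (Edge n)} {ρ x : Edge n → Bool} (hx : ∀ e ∈ F, x e = ρ e) :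
    onSet x ∩ F = F.filter fun e => ρ e = true := by
  -- adapted from Theorems/OneSliceSliceTargetFibreCliqueUpper.lean (`onSet_inter_eq`)
  ext e
  simp only [mem_inter, mem_onSet, mem_filter]
  exact ⟨fun h => ⟨h.2, (hx e h.2).symm.trans h.1⟩, fun h => ⟨(hx e h.1).trans h.2, h.1⟩⟩

/-- On the fibre of `ρ` in the slice `j`, on-set-minus-`F` is a `(j - r)`-subset of `Fᶜ`, and `r ≤ j`
(`r = #{e ∈ F : ρ e = 1}`). [folklore] -/
private theorem pb_onSet_sdiff_mem {j : ℕ} {F : Finset (Edge n)} {ρ x : Edge n → Bool}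
    (hx : x ∈ (slice n j).filter fun x => ∀ e ∈ F, x e = ρ e) :
    onSet x \ F ∈ powersetCard (j - #(F.filter fun e => ρ e = true)) Fᶜ ∧
      #(F.filter fun e => ρ e = true) ≤ j := by
  -- adapted from Theorems/OneSliceSliceTargetFibreCliqueUpper.lean (`onSet_sdiff_mem`)
  rw [mem_filter, pb_mem_slice_iff] at hx
  have hcard := card_sdiff_add_card_inter (onSet x) F
  rw [pb_onSet_inter_eq hx.2, show #(onSet x) = edgeCount x from rfl, hx.1] at hcard
  exact ⟨mem_powersetCard.2 ⟨fun e he => mem_compl.2 (Finset.mem_sdiff.1 he).2, by omega⟩, by omega⟩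

/-- On-set-minus-`F` is injective on a fibre over `F`. [folklore] -/
private theorem pb_onSet_sdiff_injOn (j : ℕ) (F : Finset (Edge n)) (ρ : Edge n → Bool) :
    Set.InjOn (fun x : Edge n → Bool => onSet x \ F)
      ↑((slice n j).filter fun x => ∀ e ∈ F, x e = ρ e) := by
  -- adapted from Theorems/OneSliceSliceTargetFibreCliqueUpper.lean (`onSet_sdiff_injOn`)
  intro x hx y hy hxy
  have hxy' : onSet x \ F = onSet y \ F := hxy
  have hx' := (mem_filter.1 (mem_coe.1 hx)).2
  have hy' := (mem_filter.1 (mem_coe.1 hy)).2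
  funext e
  by_cases he : e ∈ F
  · exact (hx' e he).trans (hy' e he).symm
  · have h : e ∈ onSet x \ F ↔ e ∈ onSet y \ F := by rw [hxy']
    simp only [Finset.mem_sdiff, mem_onSet, he, not_false_eq_true, and_true] at h
    exact Bool.eq_iff_iff.2 h

/-- **Lower count of a fibre**: `C(N - #F, j - r) ≤ #Φ(ρ)` once `r ≤ j` — the vector that is `ρ` on `F` and the
indicator of a `(j - r)`-subset `T ⊆ Fᶜ` off `F` lies in the fibre, injectively in `T`. [folklore] -/
private theorem pb_le_card_fibre {j : ℕ} (F : Finset (Edge n)) (ρ : Edge n → Bool)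
    (hr : #(F.filter fun e => ρ e = true) ≤ j) :
    (n.choose 2 - #F).choose (j - #(F.filter fun e => ρ e = true)) ≤
      #((slice n j).filter fun x => ∀ e ∈ F, x e = ρ e) := by
  -- adapted from Theorems/OneSliceSliceTargetFibreCliqueUpper.lean (`le_card_fibre`)
  set r := #(F.filter fun e => ρ e = true) with hr_def
  have hc : #(powersetCard (j - r) Fᶜ) = (n.choose 2 - #F).choose (j - r) := by
    rw [card_powersetCard, card_compl, card_edgeSet_top_fin]
  have key : ∀ T ∈ (↑(powersetCard (j - r) Fᶜ) : Set (Finset (Edge n))), ∀ e ∈ T, e ∉ F :=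
    fun T hT e he heF => (mem_compl.1 ((mem_powersetCard.1 (mem_coe.1 hT)).1 he)) heF
  rw [← hc]
  refine card_le_card_of_injOn
    (fun T : Finset (Edge n) => fun e => if e ∈ F then ρ e else decide (e ∈ T)) ?_ ?_
  · intro T hT
    beta_reduce
    have hTF := key T hT
    have hTc := (mem_powersetCard.1 (mem_coe.1 hT)).2
    rw [mem_coe, mem_filter, pb_mem_slice_iff]
    refine ⟨?_, fun e he => by simp [he]⟩
    have honT : onSet (fun e => if e ∈ F then ρ e else decide (e ∈ T)) =
        (F.filter fun e => ρ e = true) ∪ T := by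
      ext e
      rw [mem_onSet, mem_union, mem_filter]
      by_cases he : e ∈ F
      · have heT : e ∉ T := fun heT => hTF e heT he
        simp [he, heT]
      · simp [he]
    rw [← show #(onSet fun e => if e ∈ F then ρ e else decide (e ∈ T)) =
        edgeCount (fun e => if e ∈ F then ρ e else decide (e ∈ T)) from rfl, honT, card_union_of_disjoint, hTc]
    · omega
    · exact disjoint_left.2 fun e he heT => hTF e heT (mem_filter.1 he).1
  · intro T hT T' hT' hTT'
    ext e
    by_cases he : e ∈ F
    · exact ⟨fun h => absurd he (key T hT e h), fun h => absurd he (key T' hT' e h)⟩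
    · simpa [he] using congrFun hTT' e

/-- **Members of a fibre switching on a fixed `S ⊆ Fᶜ`** number at most `C(N - #F - #S, j - r - #S)` when
`#S ≤ j - r`: on-set-minus-`F` injects them into the `(j - r)`-subsets of `Fᶜ` containing `S`. [folklore] -/
private theorem pb_card_fibre_supset_le {j : ℕ} (F : Finset (Edge n)) (ρ : Edge n → Bool) (S : Finset (Edge n))
    (hSF : ∀ e ∈ S, e ∉ F) (hSj : #S ≤ j - #(F.filter fun e => ρ e = true)) :
    #(((slice n j).filter fun x => ∀ e ∈ F, x e = ρ e).filter fun x => ∀ e ∈ S, x e = true) ≤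
      (n.choose 2 - #F - #S).choose (j - #(F.filter fun e => ρ e = true) - #S) := by
  -- adapted from Theorems/OneSliceSliceTargetFibreCliqueUpper.lean (`card_fibre_supset_le`)
  set r := #(F.filter fun e => ρ e = true) with hr_def
  calc #(((slice n j).filter fun x => ∀ e ∈ F, x e = ρ e).filter fun x => ∀ e ∈ S, x e = true)
      ≤ #((powersetCard (j - r) Fᶜ).filter fun Q => S ⊆ Q) := by
        refine card_le_card_of_injOn (fun x : Edge n → Bool => onSet x \ F) ?_ ?_
        · intro x hx
          beta_reduce
          rw [mem_coe, mem_filter] at hx ⊢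
          refine ⟨(pb_onSet_sdiff_mem hx.1).1, fun e he => ?_⟩
          rw [Finset.mem_sdiff, mem_onSet]
          exact ⟨hx.2 e he, hSF e he⟩
        · exact (pb_onSet_sdiff_injOn j F ρ).mono (coe_subset.2 (filter_subset _ _))
    _ ≤ (#Fᶜ - #S).choose (j - r - #S) := card_filter_supset_powersetCard_le _ _ hSj
    _ = (n.choose 2 - #F - #S).choose (j - r - #S) := by rw [card_compl, card_edgeSet_top_fin]

/-! ## The clique count on a fibre against the fibre size -/

/-- **`c(ρ)·C(M, t) ≤ #Φ(ρ)·C(j - r, t)`**: on a nonempty fibre `Φ(ρ)` (`M = C(n,2) - #F`, `r = #(ρ⁻¹(1) ∩ F)`), the members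
switching on a fixed edge set `S` with `t = #(S ∖ F)` number at most `#Φ(ρ)·C(j-r, t)/C(M, t)`: they are
`≤ C(M - t, (j-r) - t)` (`pb_card_fibre_supset_le`), `#Φ(ρ) ≥ C(M, j-r)` (`pb_le_card_fibre`), and
`C(M-t, m-t)·C(M, t) = C(M, m)·C(m, t)` (`Nat.choose_mul`). [folklore] -/
theorem pb_fibre_count_mul_choose_le {j : ℕ} (F : Finset (Edge n)) (ρ : Edge n → Bool) (S : Finset (Edge n))
    (hne : ((slice n j).filter fun x => ∀ e ∈ F, x e = ρ e).Nonempty) :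
    #(((slice n j).filter fun x => ∀ e ∈ F, x e = ρ e).filter fun x => ∀ e ∈ S, x e = true) *
        (n.choose 2 - #F).choose #(S \ F) ≤
      #((slice n j).filter fun x => ∀ e ∈ F, x e = ρ e) * (j - #(F.filter fun e => ρ e = true)).choose #(S \ F) := by
  set Φ := (slice n j).filter fun x => ∀ e ∈ F, x e = ρ e with hΦ
  set r := #(F.filter fun e => ρ e = true) with hr
  set t := #(S \ F) with ht
  set M := n.choose 2 - #F with hM
  obtain ⟨x₀, hx₀⟩ := hne
  obtain ⟨hmem, hrj⟩ := pb_onSet_sdiff_mem hx₀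
  have hmmM : j - r ≤ M := by
    have h := card_le_card (mem_powersetCard.1 hmem).1
    rwa [(mem_powersetCard.1 hmem).2, card_compl, card_edgeSet_top_fin] at h
  by_cases htmm : t ≤ j - r
  · have h1 : #(Φ.filter fun x => ∀ e ∈ S, x e = true) ≤ #(Φ.filter fun x => ∀ e ∈ S \ F, x e = true) := by
      refine card_le_card fun x hx => ?_
      rw [mem_filter] at hx ⊢
      exact ⟨hx.1, fun e he => hx.2 e (mem_sdiff.1 he).1⟩
    have h2 : #(Φ.filter fun x => ∀ e ∈ S \ F, x e = true) ≤ (M - t).choose (j - r - t) :=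
      pb_card_fibre_supset_le F ρ (S \ F) (fun e he => (mem_sdiff.1 he).2) htmm
    have h3 : M.choose (j - r) ≤ #Φ := pb_le_card_fibre F ρ hrj
    have h4 : M.choose (j - r) * (j - r).choose t = M.choose t * (M - t).choose (j - r - t) := Nat.choose_mul htmm
    calc #(Φ.filter fun x => ∀ e ∈ S, x e = true) * M.choose t ≤ (M - t).choose (j - r - t) * M.choose t :=
          Nat.mul_le_mul_right _ (h1.trans h2)
      _ = M.choose (j - r) * (j - r).choose t := by rw [h4]; ring
      _ ≤ #Φ * (j - r).choose t := Nat.mul_le_mul_right _ h3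
  · have h0 : Φ.filter (fun x => ∀ e ∈ S, x e = true) = ∅ := by
      refine filter_eq_empty_iff.2 fun x hx hall => htmm ?_
      obtain ⟨hmemx, -⟩ := pb_onSet_sdiff_mem hx
      have h := card_le_card (show S \ F ⊆ onSet x \ F from fun e he =>
        mem_sdiff.2 ⟨(mem_onSet x e).2 (hall e (mem_sdiff.1 he).1), (mem_sdiff.1 he).2⟩)
      rwa [(mem_powersetCard.1 hmemx).2] at h
    rw [h0, card_empty, zero_mul]
    exact Nat.zero_le _

/-- No member of `Φ(ρ)` switches on `S` if `ρ` is off somewhere on `S ∩ F`. [folklore] -/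
theorem pb_fibre_count_eq_zero {j : ℕ} (F : Finset (Edge n)) (ρ : Edge n → Bool) (S : Finset (Edge n))
    (h : ¬ ∀ e ∈ S ∩ F, ρ e = true) :
    #(((slice n j).filter fun x => ∀ e ∈ F, x e = ρ e).filter fun x => ∀ e ∈ S, x e = true) = 0 := by
  rw [card_eq_zero, filter_eq_empty_iff]
  intro x hx hall
  refine h fun e he => ?_
  rw [mem_inter] at he
  rw [← (mem_filter.1 hx).2 e he.2]
  exact hall e he.1

/-- **The ratio form**: `c(ρ)/#Φ(ρ) ≤ [S ∩ F ⊆ ρ⁻¹(1)]·C(j - r, t)/C(#Fᶜ, t)` for every pattern `ρ` (both sides vanish on an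
empty fibre). [folklore] -/
theorem pb_fibre_count_div_le {j : ℕ} (F : Finset (Edge n)) (ρ : Edge n → Bool) (S : Finset (Edge n)) :
    (#(((slice n j).filter fun x => ∀ e ∈ F, x e = ρ e).filter fun x => ∀ e ∈ S, x e = true) : ℝ) /
        #((slice n j).filter fun x => ∀ e ∈ F, x e = ρ e) ≤
      if ∀ e ∈ S ∩ F, ρ e = true then
        (((j - #(F.filter fun e => ρ e = true)).choose #(S \ F) : ℕ) : ℝ) / ((#Fᶜ).choose #(S \ F) : ℕ)
      else 0 := by
  set Φ := (slice n j).filter fun x => ∀ e ∈ F, x e = ρ e with hΦ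
  have hM : #Fᶜ = n.choose 2 - #F := by rw [card_compl, card_edgeSet_top_fin]
  by_cases hall : ∀ e ∈ S ∩ F, ρ e = true
  · rw [if_pos hall]
    rcases Φ.eq_empty_or_nonempty with hΦe | hne
    · rw [hΦe, filter_empty, card_empty, Nat.cast_zero, zero_div]
      positivity
    · have hΦpos : (0 : ℝ) < #Φ := by exact_mod_cast hne.card_pos
      have htM : #(S \ F) ≤ #Fᶜ := card_le_card fun e he => mem_compl.2 (mem_sdiff.1 he).2
      have hCpos : (0 : ℝ) < ((#Fᶜ).choose #(S \ F) : ℕ) := by exact_mod_cast Nat.choose_pos htM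
      rw [div_le_div_iff₀ hΦpos hCpos, hM]
      have h : ((#(Φ.filter fun x => ∀ e ∈ S, x e = true) * (n.choose 2 - #F).choose #(S \ F) : ℕ) : ℝ) ≤
          ((#Φ * (j - #(F.filter fun e => ρ e = true)).choose #(S \ F) : ℕ) : ℝ) := by
        exact_mod_cast pb_fibre_count_mul_choose_le F ρ S hne
      push_cast at h
      linarith
  · rw [if_neg hall, pb_fibre_count_eq_zero F ρ S hall, Nat.cast_zero, zero_div]

/-! ## Union bounds and the fibrewise sum -/

/-- **Weighted union bound**: if every `x ∈ s` with `Q x` satisfies `P i x` for some `i ∈ I`, then for nonnegative weights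
`Σ_{x ∈ s, Q x} w x ≤ Σ_{i ∈ I} Σ_{x ∈ s, P i x} w x`. [folklore] -/
theorem pb_sum_filter_le_sum_sum {ι κ : Type*} (s : Finset ι) (I : Finset κ) (P : κ → ι → Prop) (Q : ι → Prop)
    [DecidablePred Q] [∀ i, DecidablePred (P i)] (w : ι → ℝ) (hw : ∀ x ∈ s, 0 ≤ w x)
    (hcov : ∀ x ∈ s, Q x → ∃ i ∈ I, P i x) :
    ∑ x ∈ s.filter Q, w x ≤ ∑ i ∈ I, ∑ x ∈ s.filter (P i), w x := by
  calc ∑ x ∈ s.filter Q, w x ≤ ∑ x ∈ s.filter Q, (#(I.filter fun i => P i x) : ℝ) * w x := by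
        refine sum_le_sum fun x hx => ?_
        obtain ⟨hxs, hQ⟩ := mem_filter.1 hx
        obtain ⟨i, hi, hP⟩ := hcov x hxs hQ
        have h1 : (1 : ℝ) ≤ #(I.filter fun i => P i x) := by
          exact_mod_cast card_pos.2 ⟨i, mem_filter.2 ⟨hi, hP⟩⟩
        nlinarith [hw x hxs]
    _ ≤ ∑ x ∈ s, (#(I.filter fun i => P i x) : ℝ) * w x :=
        sum_le_sum_of_subset_of_nonneg (filter_subset _ _) fun x hx _ => mul_nonneg (Nat.cast_nonneg _) (hw x hx)
    _ = ∑ x ∈ s, ∑ i ∈ I, if P i x then w x else 0 := by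
        refine sum_congr rfl fun x _ => ?_
        rw [← sum_filter, sum_const, nsmul_eq_mul]
    _ = ∑ i ∈ I, ∑ x ∈ s.filter (P i), w x := by
        rw [sum_comm]
        exact sum_congr rfl fun i _ => (sum_filter _ _).symm

/-- **The triple-sum reduction, registered form** (helper of stub B3 `stub_pairBound`): with `𝒜` the `k`-sets,
`K_A = {e : cliqueVec A e}`, `t_B = #(K_B ∖ F)`,
`Σ_ρ a(ρ)²/#Φ(ρ) ≤ Σ_{B ∈ 𝒜} Σ_{A ∈ 𝒜} Σ_{x ∈ slice_j, K_A ∪ (K_B ∩ F) ⊆ x} C(#(x ∖ F), t_B)/C(#Fᶜ, t_B)`. Steps: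
`a(ρ) ≤ Σ_B c_B(ρ)` (a clique graph contains some `K_B`), `c_B(ρ)/#Φ(ρ) ≤ [K_B ∩ F ⊆ ρ⁻¹(1)]·C(j-r, t_B)/C(#Fᶜ, t_B)`
(`pb_fibre_count_div_le`), `Σ_ρ a(ρ)·g(ρ) = Σ_{x clique} g(x|_F)` (fibrewise), union bound over the clique of `x`, and
`j - r = #(x ∖ F)` on the slice. [folklore] -/
theorem pb_replicaTripleSum :
    ∀ (n k j : ℕ) (F : Finset (Edge n)),
      ∑ ρ ∈ (slice n j).image (fun x e => if e ∈ F then x e else false),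
          (#((slice n j).filter fun x => (∀ e ∈ F, x e = ρ e) ∧ cliqueFn n k x = true) : ℝ) ^ 2 /
            #((slice n j).filter fun x => ∀ e ∈ F, x e = ρ e) ≤
        ∑ B ∈ powersetCard k (univ : Finset (Fin n)), ∑ A ∈ powersetCard k (univ : Finset (Fin n)),
          ∑ x ∈ (slice n j).filter (fun x => ∀ e ∈ (univ.filter fun e : Edge n => cliqueVec A e = true) ∪
              ((univ.filter fun e : Edge n => cliqueVec B e = true) ∩ F), x e = true),
            (((#(onSet x \ F)).choose #((univ.filter fun e : Edge n => cliqueVec B e = true) \ F) : ℕ) : ℝ) /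
              ((#Fᶜ).choose #((univ.filter fun e : Edge n => cliqueVec B e = true) \ F) : ℕ) := by
  intro n k j F
  set 𝒜 := powersetCard k (univ : Finset (Fin n)) with h𝒜
  set pat : (Edge n → Bool) → (Edge n → Bool) := fun x e => if e ∈ F then x e else false with hpat
  set Sv : Finset (Fin n) → Finset (Edge n) := fun A => univ.filter fun e : Edge n => cliqueVec A e = true with hSv
  set C := (slice n j).filter fun x => cliqueFn n k x = true with hC
  set G : Finset (Fin n) → (Edge n → Bool) → ℝ := fun B ρ =>
    if ∀ e ∈ Sv B ∩ F, ρ e = true then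
      (((j - #(F.filter fun e => ρ e = true)).choose #(Sv B \ F) : ℕ) : ℝ) / ((#Fᶜ).choose #(Sv B \ F) : ℕ)
    else 0 with hG
  have hG0 : ∀ B ρ, 0 ≤ G B ρ := fun B ρ => by
    simp only [hG]
    split_ifs
    · positivity
    · exact le_rfl
  -- a clique graph contains the clique edge set of some `k`-set
  have hcov : ∀ x : Edge n → Bool, cliqueFn n k x = true → ∃ B ∈ 𝒜, ∀ e ∈ Sv B, x e = true := by
    intro x hcl
    have hne := (cliqueCount_ne_zero_iff x).2 hcl
    rw [Ne, cliqueCount_eq_zero_iff_forall] at hne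
    push Not at hne
    obtain ⟨B, hB, hBx⟩ := hne
    exact ⟨B, hB, fun e he => hBx e (mem_filter.1 he).2⟩
  -- Step 1: `a(ρ)²/#Φ(ρ) ≤ a(ρ)·Σ_B G_B(ρ)`
  have step1 : ∀ ρ : Edge n → Bool,
      (#((slice n j).filter fun x => (∀ e ∈ F, x e = ρ e) ∧ cliqueFn n k x = true) : ℝ) ^ 2 /
          #((slice n j).filter fun x => ∀ e ∈ F, x e = ρ e) ≤
        (#((slice n j).filter fun x => (∀ e ∈ F, x e = ρ e) ∧ cliqueFn n k x = true) : ℝ) * ∑ B ∈ 𝒜, G B ρ := by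
    intro ρ
    set Φ := (slice n j).filter fun x => ∀ e ∈ F, x e = ρ e with hΦ
    set a := #((slice n j).filter fun x => (∀ e ∈ F, x e = ρ e) ∧ cliqueFn n k x = true) with ha
    have hub : a ≤ ∑ B ∈ 𝒜, #(Φ.filter fun x => ∀ e ∈ Sv B, x e = true) := by
      calc a ≤ #(𝒜.biUnion fun B => Φ.filter fun x => ∀ e ∈ Sv B, x e = true) := by
            refine card_le_card fun x hx => ?_
            obtain ⟨hxs, hxρ, hcl⟩ := mem_filter.1 hx
            obtain ⟨B, hB, hBx⟩ := hcov x hcl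
            exact mem_biUnion.2 ⟨B, hB, mem_filter.2 ⟨mem_filter.2 ⟨hxs, hxρ⟩, hBx⟩⟩
        _ ≤ _ := card_biUnion_le
    have hGB : ∀ B ∈ 𝒜, (#(Φ.filter fun x => ∀ e ∈ Sv B, x e = true) : ℝ) / #Φ ≤ G B ρ :=
      fun B _ => pb_fibre_count_div_le F ρ (Sv B)
    calc (a : ℝ) ^ 2 / #Φ = (a : ℝ) * ((a : ℝ) / #Φ) := by rw [sq, mul_div_assoc]
      _ ≤ (a : ℝ) * (((∑ B ∈ 𝒜, #(Φ.filter fun x => ∀ e ∈ Sv B, x e = true) : ℕ) : ℝ) / #Φ) :=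
          mul_le_mul_of_nonneg_left (div_le_div_of_nonneg_right (by exact_mod_cast hub) (Nat.cast_nonneg _))
            (Nat.cast_nonneg _)
      _ = (a : ℝ) * ∑ B ∈ 𝒜, (#(Φ.filter fun x => ∀ e ∈ Sv B, x e = true) : ℝ) / #Φ := by
          rw [Nat.cast_sum, sum_div]
      _ ≤ (a : ℝ) * ∑ B ∈ 𝒜, G B ρ := mul_le_mul_of_nonneg_left (sum_le_sum hGB) (Nat.cast_nonneg _)
  -- Step 2: the fibrewise sum `Σ_ρ a(ρ)·g(ρ) = Σ_{x clique} g(x)`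
  have hpatF : ∀ x : Edge n → Bool, ∀ e ∈ F, pat x e = x e := fun x e he => by simp [hpat, he]
  have hfib : ∀ ρ ∈ (slice n j).image pat, ∀ x : Edge n → Bool, ((∀ e ∈ F, x e = ρ e) ↔ pat x = ρ) := by
    intro ρ hρ x
    obtain ⟨x₀, -, rfl⟩ := mem_image.1 hρ
    constructor
    · intro h
      funext e
      by_cases he : e ∈ F
      · rw [hpatF x e he, h e he]
      · simp [hpat, he]
    · intro h e he
      rw [← h, hpatF x e he]
  have hGpat : ∀ B x, G B (pat x) = G B x := by
    intro B x
    have h1 : (∀ e ∈ Sv B ∩ F, pat x e = true) ↔ (∀ e ∈ Sv B ∩ F, x e = true) :=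
      forall₂_congr fun e he => by rw [hpatF x e (mem_inter.1 he).2]
    have h2 : F.filter (fun e => pat x e = true) = F.filter (fun e => x e = true) :=
      filter_congr fun e he => by rw [hpatF x e he]
    simp only [hG]
    by_cases hc : ∀ e ∈ Sv B ∩ F, x e = true
    · rw [if_pos hc, if_pos (h1.2 hc), h2]
    · rw [if_neg hc, if_neg (mt h1.1 hc)]
  have step2 : ∑ ρ ∈ (slice n j).image pat,
      (#((slice n j).filter fun x => (∀ e ∈ F, x e = ρ e) ∧ cliqueFn n k x = true) : ℝ) * ∑ B ∈ 𝒜, G B ρ =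
        ∑ x ∈ C, ∑ B ∈ 𝒜, G B x := by
    have hmaps : ∀ x ∈ C, pat x ∈ (slice n j).image pat := fun x hx => mem_image_of_mem _ (mem_filter.1 hx).1
    calc ∑ ρ ∈ (slice n j).image pat,
          (#((slice n j).filter fun x => (∀ e ∈ F, x e = ρ e) ∧ cliqueFn n k x = true) : ℝ) * ∑ B ∈ 𝒜, G B ρ
        = ∑ ρ ∈ (slice n j).image pat, ∑ x ∈ C with pat x = ρ, ∑ B ∈ 𝒜, G B ρ := by
          refine sum_congr rfl fun ρ hρ => ?_
          rw [sum_const, nsmul_eq_mul]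
          congr 2
          rw [hC, filter_filter]
          congr 1
          refine filter_congr fun x _ => ?_
          rw [hfib ρ hρ x]
          tauto
      _ = ∑ x ∈ C, ∑ B ∈ 𝒜, G B (pat x) := sum_fiberwise_of_maps_to' hmaps _
      _ = ∑ x ∈ C, ∑ B ∈ 𝒜, G B x := sum_congr rfl fun x _ => sum_congr rfl fun B _ => hGpat B x
  -- Step 3: second union bound (over the clique of `x`)
  have step3 : ∀ B ∈ 𝒜, ∑ x ∈ C, G B x ≤
      ∑ A ∈ 𝒜, ∑ x ∈ (slice n j).filter (fun x => ∀ e ∈ Sv A, x e = true), G B x := by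
    intro B _
    exact pb_sum_filter_le_sum_sum (slice n j) 𝒜 (fun A x => ∀ e ∈ Sv A, x e = true)
      (fun x => cliqueFn n k x = true) (G B) (fun x _ => hG0 B x) (fun x _ hx => hcov x hx)
  -- Step 4: `G_B` on the slice: `j - r = #(x ∖ F)`
  have step4 : ∀ A B, ∑ x ∈ (slice n j).filter (fun x => ∀ e ∈ Sv A, x e = true), G B x =
      ∑ x ∈ (slice n j).filter (fun x => ∀ e ∈ Sv A ∪ (Sv B ∩ F), x e = true),
        (((#(onSet x \ F)).choose #(Sv B \ F) : ℕ) : ℝ) / ((#Fᶜ).choose #(Sv B \ F) : ℕ) := by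
    intro A B
    simp only [hG]
    rw [← sum_filter, filter_filter]
    have hset : (slice n j).filter (fun x => (∀ e ∈ Sv A, x e = true) ∧ ∀ e ∈ Sv B ∩ F, x e = true) =
        (slice n j).filter (fun x => ∀ e ∈ Sv A ∪ (Sv B ∩ F), x e = true) := by
      refine filter_congr fun x _ => ?_
      simp only [mem_union]
      exact ⟨fun h e he => he.elim (h.1 e) (h.2 e), fun h => ⟨fun e he => h e (Or.inl he), fun e he => h e (Or.inr he)⟩⟩
    rw [hset]
    refine sum_congr rfl fun x hx => ?_
    have hxs : x ∈ slice n j := (mem_filter.1 hx).1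
    have hcard := card_sdiff_add_card_inter (onSet x) F
    rw [pb_onSet_inter_eq (F := F) (ρ := x) (fun e _ => rfl), show #(onSet x) = edgeCount x from rfl,
      pb_mem_slice_iff.1 hxs] at hcard
    rw [show j - #(F.filter fun e => x e = true) = #(onSet x \ F) by omega]
  -- assemble
  calc ∑ ρ ∈ (slice n j).image pat,
        (#((slice n j).filter fun x => (∀ e ∈ F, x e = ρ e) ∧ cliqueFn n k x = true) : ℝ) ^ 2 /
          #((slice n j).filter fun x => ∀ e ∈ F, x e = ρ e)
      ≤ ∑ ρ ∈ (slice n j).image pat,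
          (#((slice n j).filter fun x => (∀ e ∈ F, x e = ρ e) ∧ cliqueFn n k x = true) : ℝ) * ∑ B ∈ 𝒜, G B ρ :=
        sum_le_sum fun ρ _ => step1 ρ
    _ = ∑ x ∈ C, ∑ B ∈ 𝒜, G B x := step2
    _ = ∑ B ∈ 𝒜, ∑ x ∈ C, G B x := sum_comm
    _ ≤ ∑ B ∈ 𝒜, ∑ A ∈ 𝒜, ∑ x ∈ (slice n j).filter (fun x => ∀ e ∈ Sv A, x e = true), G B x := sum_le_sum step3
    _ = _ := sum_congr rfl fun B _ => sum_congr rfl fun A _ => step4 A B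

end

end Summit.PneNP.PneNP.Cruxes.SliceTarget.Ideator3Line
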